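import Mathlib
import Summits.Ventures.PercRepro2.Defs
import Summits.Ventures.PercRepro2.Independence
import Summits.Ventures.PercRepro2.Harris
import Summits.Ventures.PercRepro2.Graph
import Summits.Ventures.PercRepro2.Events
import Summits.Ventures.PercRepro2.BoxUnionDefs
import Summits.Ventures.PercRepro2.BoxUnion
import Summits.Ventures.PercRepro2.BoxUnionPair
import Summits.Ventures.PercRepro2.CondAvoidPA
import Summits.Ventures.PercRepro2.PairTP2
import Summits.Ventures.PercRepro2.PairTP2Main
import Summits.Ventures.PercRepro2.SeparatedDefs
import Summits.Ventures.PercRepro2.SeparatedPair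

/-!
# The union row for two observed vertices on the whole positive class of (PAIR-TP2)
(blind cell PercRepro2, mine-1 g38; proofs/MINE1-PAIRTP2.md §4 (2))

For `u ≠ v` off the terminals such that `(u, v)` is not linkable or `u, v` lie in different
components of `G − {s, t}`, and `P(s ↮ t) > 0`: for all `f, g` increasing in the `C_s`-status and
decreasing in the `C_t`-status of `{u, v}` and all `X, Y ⊆ {u, v}`,

  `E[(f(σ) − E[f(σ) | Q]) (g(σ) − E[g(σ) | Q]) · 1_{Q ∩ ({s ↮ X} ∪ {t ↮ Y})}] ≥ 0`,  `Q = {s ↮ t}`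

— the (Z)-reading of the union row (`BoxUnionPair.hit_boxUnion_nonneg`) fed with the
log-supermodularity of the two-vertex status law
(`PairTP2.pairLaw_lsm_of_not_linkable_or_not_interfaced`).
-/

namespace Summit.Ventures.PercRepro2

namespace PairTP2

open Finset Separated
open scoped Classical

variable {V : Type*} {E : Type*} [Fintype V] [DecidableEq V] [Fintype E] [DecidableEq E]
variable (ends : E → Sym2 V) (s t : V) {u v : V} {p : E → ℝ}

/-- **The union row for observables of two statuses, on the whole positive class of
(PAIR-TP2)** (kernel). -/
theorem hit_boxUnion_nonneg_of_pairTP2 (hne : u ≠ v) (hu : u ∉ ({s, t} : Set V))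
    (hv : v ∉ ({s, t} : Set V)) (h : NotLinkable ends s t u v ∨ v ∉ comp ends s t u)
    (hp : IsProbVec p) (hQ : 0 < prob p (connEvent ends s t)ᶜ) {f g : Finset V → Finset V → ℝ}
    (hf : ∀ ⦃W W' C C' : Finset V⦄, W ⊆ W' → C' ⊆ C → f W C ≤ f W' C')
    (hg : ∀ ⦃W W' C C' : Finset V⦄, W ⊆ W' → C' ⊆ C → g W C ≤ g W' C')
    {X Y : Finset V} (hX : X ⊆ {u, v}) (hY : Y ⊆ {u, v}) :
    0 ≤ expect p (((connEvent ends s t)ᶜ ∩ ((hitEvent ends s X)ᶜ ∪ (hitEvent ends t Y)ᶜ)).indicator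
      (fun ω =>
        (f (BoxUnionPair.status ends {u, v} s t ω).1
              (OrderDual.ofDual (BoxUnionPair.status ends {u, v} s t ω).2) -
            BoxUnionPair.condMean p ends {u, v} s t (fun k => f k.1 (OrderDual.ofDual k.2))) *
          (g (BoxUnionPair.status ends {u, v} s t ω).1
              (OrderDual.ofDual (BoxUnionPair.status ends {u, v} s t ω).2) -
            BoxUnionPair.condMean p ends {u, v} s t (fun k => g k.1 (OrderDual.ofDual k.2))))) :=
  BoxUnionPair.hit_boxUnion_nonneg ends {u, v} s t hp
    (pairLaw_lsm_of_not_linkable_or_not_interfaced ends s t u v hne hu hv h hp) hQ hf hg hX hY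

end PairTP2

end Summit.Ventures.PercRepro2
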